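import Summits.ValiantsHypothesis.ValiantsHypothesis.Theses.ProjectionStability
import Literature.Computability.AlgebraicComplexity.GrenetEquivariant
import Literature.Computability.AlgebraicComplexity.DetReprEquivalent
import Literature.Computability.AlgebraicComplexity.DeterminantalComplexityProofs
import Summits.ValiantsHypothesis.ValiantsHypothesis.Theorems.ProjectionStabilityOptStepStubGrenetProjection
import Summits.ValiantsHypothesis.ValiantsHypothesis.Theorems.ProjectionStabilityUniqStepStubOptimalStructure
import Summits.ValiantsHypothesis.ValiantsHypothesis.Theorems.ProjectionStabilityUniqStepStubLrEqualityNormalForm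
import Summits.ValiantsHypothesis.ValiantsHypothesis.Theorems.ProjectionStabilityUniqStepStubOrbitProportional
import Summits.ValiantsHypothesis.ValiantsHypothesis.Theorems.ProjectionStabilityUniqStepStubGradedRigidity
import Summits.ValiantsHypothesis.ValiantsHypothesis.Theorems.ProjectionStabilityUniqStepStubSwapBookkeeping

/-!
# Line `Sketch` (equivariance split: "optimality forces the left monomial symmetry" +
# "equality case of Landsberg–Ressayre Thm. 2.8 is rigid") — skeleton for crux
# `ProjectionStability.UniqStep` (stmt-ValiantsHypothesis-17834)

Crux (by name): `Summit.ValiantsHypothesis.ValiantsHypothesis.Theses.ProjectionStability.UniqStep` =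
`∀ n ≥ 3, Opt n → Uniq n → Opt (n+1) → Uniq (n+1)` with `Opt k := 2ᵏ − 1 ≤ pdc(per_k)`
(`pdc = detProjectionComplexity`, Valiant's projection model: every cell a variable or a constant) and
`Uniq k :=` any two optimal honest projections of `per_k` are `DetReprEquivalent (permSymmetrySubst ℂ k)`
(constant gauge `GL × GL`, a realised symmetry of `per_k`, possibly matrix transposition).

## The line (cards `Cruxes/UniqStep/Ideas/weights-as-layers.md` — transfer `uniq_of_equivariance :
## EqForced → EquivUniq → Uniq` of the ideator's `Sketch.lean` — and `torus-waist-exact-covers.md`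
## (`uniqStep_of_torus : TorStep → TorUniq → UniqStep`); rebuilt here because the evidence store is not
## mounted in this jail, and re-typed for the LEFT MONOMIAL symmetry `leftMonomialSubst` so that the
## provable half is the EQUALITY CASE of LR17 Thm. 2.8, whose proof is complete in the tree)

TRANSFER (proved below, `UniqStep_of`): let `N = n + 1` and `A`, `B` be honest optimal projections of
`per_N`. By S7 (`stub_symForced`, THE BET; = the OptStep line's `SymStep` weakened by the extra hypothesis
`Opt (n+1)`) each of them — or its variable-transpose `·.map (rename Prod.swap)`, which is in the same
`permSymmetrySubst`-class (S6) — is an exactly-lifted `leftMonomialSubst ℂ N`-equivariant representation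
of `per_N`; its size is `pdc(per_N) = 2^N − 1` (S1 + `Opt N`), i.e. EQUALITY in LR17 Thm. 2.8; by S3 it is
gauge-equivalent to a GRADED GENERALISED GRENET MATRIX `G(a, e)` (Grenet's branching program on the subsets
of `Fin N` whose arc `S → insert k S` carries an arbitrary linear form `∑_c a S k c · X (k, c)` in the
row-`k` variables instead of `X (k, |S|)`); by S4 the symmetry forces the forms of one level to be
proportional (`a S k c = ρ S k · α |S| c`), and by S5 such a graded matrix with `det = per_N` is Grenet's
up to gauge and a right monomial substitution (all `∅ → univ` path products of `ρ` agree, and the linear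
map `α` preserves `∏_c v_c`, hence is monomial: the one-sided Marcus–May argument). So `A ~ Grenet.repr ~ B`.

REGISTERED STUBS (the only `sorry`s):
* S1 `stub_grenetProjection` — `IsDetProjection per_n (2ⁿ − 1)` (= OptStep line S2 = parent support
  `ProjectionRigidity.GrenetProjection`); pins `pdc(per_N) + 1 = 2^N` under `Opt N`. Size M.
* S2 `stub_optimalStructure` — (a) `IsDetProjection (c • per_N) m → IsDetProjection per_N m` (`N ≥ 3`,
  `c ≠ 0`: divide the constant cells by `μ` with `μ^(m−N) = c`; `m = N` is impossible by Mignon–Ressayre);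
  (b) FULL INDECOMPOSABILITY of optimal honest projections: no `r × s` zero block with `r + s ≥ pdc`
  (Frobenius–König factorisation `det = det B₁ · det B₂`, `perPoly_irreducible`, (a), minimality of `pdc`).
  Threaded into S7 (the bet's first structural input). Size M+L.
* S3 `stub_lrEqualityNormalForm` — equality case of LR17 Thm. 2.8, STRUCTURE: an `L`-equivariant affine
  representation of `per_N` (`N ≥ 3`) of size `2^N − 1` is `⊥`-equivalent to some `G(a, e)` with
  `det G(a,e) = per_N` (canonical subspaces `LRCanonicalSubspaces`, one generic torus lift
  `GenericTorusGrading`/`LRTorusWeights`, the count `LRWeightCount.two_pow_sub_one_le_finrank` at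
  equality: every weight `𝟙_S` occurs exactly once, weight spaces are lines, `Λ` and the coefficient
  matrices are graded). Size XL.
* S4 `stub_orbitProportional` — equality case, SYMMETRY: if `G(a, e)` is `L`-equivariant then the forms of
  one level are proportional, `a S k c = ρ S k · α |S| c` (`k ∉ S`) (permutation lifts permute the two-sided
  canonical filtrations `Lift.map_canon_eq`, hence the weight lines). Size L.
* S5 `stub_gradedRigidity` — RIGIDITY: `G(a, e)` with proportional levels and `det = per_N` is
  `DetReprEquivalent (permSymmetrySubst ℂ N)` to `Grenet.repr ℂ N e`. Size L.
* S6 `stub_swapBookkeeping` — `rename Prod.swap per_N = per_N`; `A ~ A.map (rename Prod.swap)` via the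
  transposition substitution `transposeSubstSet ⊆ permSymmetrySubst`. Size S/M.
* S7 `stub_symForced` — THE BET: `Opt n → Uniq n → Opt (n+1) →` every honest optimal projection of
  `per_{n+1}` is `L`-equivariant, or its variable-transpose is. Size XL (open).

## Status (2026-08-17, end of wave 1)
S1 = `…Theorems.ProjectionStabilityOptStep.GrenetProjection.stub_grenetProjection` (landed by the OptStep line,
p147445); S2 p151148, S3 p155767, S4 p157058, S5 p153216, S6 p151603 landed under
`Theorems/ProjectionStabilityUniqStepStub*.lean` (with the Literature files GrenetWeightedPaths,
GrenetPathPotentials, WeightedPermanentRigidity, LREqualityWeights, GeneralisedGrenetMatrix,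
GrenetGradedNormalForm, GrenetPencilCanonicalSubspaces, GrenetPencilOrbitProportional). The only `sorry`
left is S7, the bet; `UniqStep_of` is the crux modulo S7, and S7 is EQUIVALENT to the crux given S1–S6
(OptStep's `stub_halfEq_of_uniq` gives the converse direction at every level).

## Disproof.lean used
None is published for this crux yet (`ledger crux ls`: Ideas only, 2026-08-17; the disprover's session file
is not mounted here). Honoured: the landed Negative lemma
`…Theorems.UniqStep.Negative.uniq_three_false_with_signed_entries` (coefficient-one is load-bearing): only
S7 speaks about honest matrices, and its conclusion fails for the signed twist (it is not torus-equivariant,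
card torus-waist §Disproof), so honesty is consumed exactly there; S3–S5 are about affine equivariant
representations and do not need it. Refuter cycle-1 notes (tangent rigidity of Grenet₃/₄, no second orbit
at Hamming distance ≤ 2, corank lead dead = regularity) are consistent with S3–S5 and used (regularity).
-/

set_option linter.unusedVariables false
set_option linter.dupNamespace false

namespace Summit.ValiantsHypothesis.ValiantsHypothesis.Cruxes.UniqStep.Sketch

open MvPolynomial
open scoped BigOperators Matrix
open Literature.Computability.AlgebraicComplexity

noncomputable section

/-! ## Registered stubs (the ONLY places `sorry` may appear) -/

/-- **S1 — Grenet's representation is a strict projection** (`n ≥ 1`): `per_n` is a projection of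
`DET_{2ⁿ−1}` (choose `e : Finset (Fin n) ≃ Fin 2ⁿ`; every cell of `Grenet.repr ℂ n e` is `X (j, c)`,
`C (-1)`, `C 1` or `C 0` up to the global sign, and `det = per_n`, `Grenet.isAffineDetRepr_repr`).
Verbatim the OptStep line's S2 and the parent support `ProjectionRigidity.GrenetProjection`
(stmt-ValiantsHypothesis-16006). Size M. [Grenet2011 Thm. 1] -/
theorem stub_grenetProjection :
    ∀ n : ℕ, 1 ≤ n → IsDetProjection (perPoly (Fin n) ℂ) (2 ^ n - 1) :=
  Theorems.ProjectionStabilityOptStep.GrenetProjection.stub_grenetProjection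

/-- **S2 — structure of optimal honest projections.** (a) SCALING: for `N ≥ 3` and `c ≠ 0`, if
`c • per_N` is a projection of `DET_m` then so is `per_N` (for `m ≠ N` divide every constant cell by
`μ` with `μ^(m-N) = c`: `det (μ⁻¹ • A(μ x)) = μ^(N-m) det A`; `m = N` is impossible by Mignon–Ressayre
`sq_le_two_mul_of_hasDetRepr_perPoly`). (b) FULL INDECOMPOSABILITY: an honest matrix of the optimal size
`pdc(per_N)` with `det = per_N` has no zero block on rows `R` and columns `C` with `|R| + |C| ≥ pdc`
(`|R| + |C| > pdc` kills every term of `det`; `|R| + |C| = pdc` makes `A` block triangular after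
permuting rows and columns, `det A = ± det B₁ · det B₂` with honest square blocks, `perPoly_irreducible`
makes one factor a non-zero constant, and the other block is a smaller projection of `c • per_N`,
contradicting (a) and the minimality of `pdc`). Size M+L. [folklore; Frobenius–König] -/
theorem stub_optimalStructure :
    (∀ (N m : ℕ) (c : ℂ), 3 ≤ N → c ≠ 0 →
        IsDetProjection (c • perPoly (Fin N) ℂ) m → IsDetProjection (perPoly (Fin N) ℂ) m) ∧
    (∀ N : ℕ, 3 ≤ N →
      ∀ A : Matrix (Fin (detProjectionComplexity (perPoly (Fin N) ℂ)))
          (Fin (detProjectionComplexity (perPoly (Fin N) ℂ))) (MvPolynomial (Fin N × Fin N) ℂ),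
        (∀ i j, (∃ v, A i j = X v) ∨ ∃ c, A i j = C c) → A.det = perPoly (Fin N) ℂ →
        ∀ R C : Finset (Fin (detProjectionComplexity (perPoly (Fin N) ℂ))), R.Nonempty → C.Nonempty →
          (∀ i ∈ R, ∀ j ∈ C, A i j = 0) →
          R.card + C.card < detProjectionComplexity (perPoly (Fin N) ℂ)) :=
  Theorems.ProjectionStabilityUniqStep.stub_optimalStructure

/-- **S3 — equality case of Landsberg–Ressayre Thm. 2.8, structure (graded normal form).** For `N ≥ 3`,
an affine determinantal representation `A` of `per_N` of size `m = 2^N − 1` which is equivariant (exact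
lifts) for the left monomial symmetries is, for every indexing `e` of the subsets of `Fin N`, gauge/transpose-
equivalent (`DetReprEquivalent ⊥`) to a GENERALISED GRENET MATRIX with `det = per_N`: Grenet's branching
program on the subsets (`Grenet.repr`: the `(univ, ∅)` minor of `1 − adj`, sign `(−1)^(e univ + e ∅)`) in
which the arc `S → insert k S` carries the linear form `∑_c a S k c · X (k, c)`. Mechanism: regularity
(`isRegularDetRepr_perPoly`), one generic torus lift and its generalised eigenspaces
(`GenericTorusGrading`, `LRTorusWeights.TorusData`), the canonical subspaces `LRCanonicalSubspaces.canon`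
and the count `LRWeightCount.two_pow_sub_one_le_finrank` — at equality every weight `wt 𝟙_S` (`S ≠ ∅`)
has a ONE-dimensional weight space and these exhaust the space, `Λ` has degree `0` and the coefficient
matrix of `X (k, c)` degree `e_k`, which in an adapted basis is exactly the displayed shape; the level
scalings absorb `det P · det Q`. Size XL. [LandsbergRessayre2017 Thm. 2.8, §6; folklore (equality case)] -/
theorem stub_lrEqualityNormalForm :
    ∀ (N m : ℕ), 3 ≤ N → m + 1 = 2 ^ N →
      ∀ A : Matrix (Fin m) (Fin m) (MvPolynomial (Fin N × Fin N) ℂ),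
        IsEquivariantDetRepr (leftMonomialSubst ℂ N) (perPoly (Fin N) ℂ) A →
        ∀ e : Finset (Fin N) ≃ Fin (m + 1),
          ∃ a : Finset (Fin N) → Fin N → Fin N → ℂ,
            ((-1 : MvPolynomial (Fin N × Fin N) ℂ) ^ ((e Finset.univ : ℕ) + (e ∅ : ℕ)) •
                (((1 - Matrix.of fun S T : Finset (Fin N) =>
                    ∑ k : Fin N, if k ∉ S ∧ T = insert k S
                      then ∑ c : Fin N, a S k c • (X (k, c) : MvPolynomial (Fin N × Fin N) ℂ)
                      else 0).submatrix e.symm e.symm).submatrix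
                  (Fin.succAbove (e Finset.univ)) (Fin.succAbove (e ∅)))).det = perPoly (Fin N) ℂ ∧
            DetReprEquivalent ⊥ A
              ((-1 : MvPolynomial (Fin N × Fin N) ℂ) ^ ((e Finset.univ : ℕ) + (e ∅ : ℕ)) •
                (((1 - Matrix.of fun S T : Finset (Fin N) =>
                    ∑ k : Fin N, if k ∉ S ∧ T = insert k S
                      then ∑ c : Fin N, a S k c • (X (k, c) : MvPolynomial (Fin N × Fin N) ℂ)
                      else 0).submatrix e.symm e.symm).submatrix
                  (Fin.succAbove (e Finset.univ)) (Fin.succAbove (e ∅)))) :=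
  Theorems.ProjectionStabilityUniqStep.stub_lrEqualityNormalForm

/-- **S4 — equality case, symmetry: the forms of one level are proportional.** If a generalised Grenet
matrix `G(a, e)` (`N ≥ 3`, size `2^N − 1`) is an exactly-lifted `leftMonomialSubst ℂ N`-equivariant
representation of `per_N`, then there are scalars `ρ S k` and level forms `α ℓ` with
`a S k c = ρ S k · α |S| c` for all `k ∉ S`. Mechanism: `G(a, e)` is graded (diagonal torus lifts with
distinct characters on the `2^N − 1` lines); the lift `(B_σ, C_σ)` of a row permutation `σ` maps the
canonical subspace `𝒫_S` onto `𝒫_{σ S}` (`LRPencil.Lift.map_canon_eq`) and likewise for the dual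
(transposed) filtration, and at equality `𝒫_S = ⊕_{∅ ≠ T ⊆ S} line_T`, so `B_σ` maps `line_S` onto
`line_{σ S}`; reading `B_σ A_{k c} = A_{σ k, c} C_σ` on lines gives `a (σS) (σk) · = λ · a S k ·` with
`λ ≠ 0`, and `𝔖_N` is transitive on the arcs of one level. Size L. [LandsbergRessayre2017 §6; folklore] -/
theorem stub_orbitProportional :
    ∀ (N m : ℕ), 3 ≤ N → m + 1 = 2 ^ N →
      ∀ (e : Finset (Fin N) ≃ Fin (m + 1)) (a : Finset (Fin N) → Fin N → Fin N → ℂ),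
        IsEquivariantDetRepr (leftMonomialSubst ℂ N) (perPoly (Fin N) ℂ)
          ((-1 : MvPolynomial (Fin N × Fin N) ℂ) ^ ((e Finset.univ : ℕ) + (e ∅ : ℕ)) •
            (((1 - Matrix.of fun S T : Finset (Fin N) =>
                ∑ k : Fin N, if k ∉ S ∧ T = insert k S
                  then ∑ c : Fin N, a S k c • (X (k, c) : MvPolynomial (Fin N × Fin N) ℂ)
                  else 0).submatrix e.symm e.symm).submatrix
              (Fin.succAbove (e Finset.univ)) (Fin.succAbove (e ∅)))) →
        ∃ (ρ : Finset (Fin N) → Fin N → ℂ) (α : ℕ → Fin N → ℂ),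
          ∀ (S : Finset (Fin N)) (k c : Fin N), k ∉ S → a S k c = ρ S k * α S.card c :=
  Theorems.ProjectionStabilityUniqStep.stub_orbitProportional

/-- **S5 — rigidity of graded generalised Grenet matrices.** If `G(a, e)` (`N ≥ 3`, size `2^N − 1`) has
proportional levels `a S k c = ρ S k · α |S| c` (`k ∉ S`) and `det G(a, e) = per_N`, then it is
`DetReprEquivalent (permSymmetrySubst ℂ N)` to Grenet's matrix `Grenet.repr ℂ N e`. Mechanism:
`det G(a,e) = Σ_{orderings π of Fin N} w(π) ∏_t α t (x_{π t, ·})` with `w(π) = ∏ ρ` along the path; as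
an identity `= per_N (x)` it says, after the substitution `x ↦ x · (αᵀ)⁻¹` (`α` is invertible), that the
symmetric `N`-linear form `Per` takes the same values on the rows of `b = (αᵀ)⁻¹` as on the standard basis;
hence `w` is constant (`per` is invariant under row permutations), every `∅ → univ` path product of `ρ`
agrees (so `ρ` is a diagonal-gauge coboundary), and `v ↦ b v` preserves `∏_c v_c`, hence is monomial
(degree in each `v_c`); a monomial `α` with the level normalisation is the right monomial substitution
`x ↦ x · Q ∈ rightMonomialSubst ⊆ permSymmetrySubst` applied to `Grenet.repr`. Size L. [folklore;
Marcus–May 1962 (one-sided)] -/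
theorem stub_gradedRigidity :
    ∀ (N m : ℕ), 3 ≤ N → m + 1 = 2 ^ N →
      ∀ (e : Finset (Fin N) ≃ Fin (m + 1)) (a : Finset (Fin N) → Fin N → Fin N → ℂ)
        (ρ : Finset (Fin N) → Fin N → ℂ) (α : ℕ → Fin N → ℂ),
        (∀ (S : Finset (Fin N)) (k c : Fin N), k ∉ S → a S k c = ρ S k * α S.card c) →
        ((-1 : MvPolynomial (Fin N × Fin N) ℂ) ^ ((e Finset.univ : ℕ) + (e ∅ : ℕ)) •
            (((1 - Matrix.of fun S T : Finset (Fin N) =>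
                ∑ k : Fin N, if k ∉ S ∧ T = insert k S
                  then ∑ c : Fin N, a S k c • (X (k, c) : MvPolynomial (Fin N × Fin N) ℂ)
                  else 0).submatrix e.symm e.symm).submatrix
              (Fin.succAbove (e Finset.univ)) (Fin.succAbove (e ∅)))).det = perPoly (Fin N) ℂ →
        DetReprEquivalent (permSymmetrySubst ℂ N)
          ((-1 : MvPolynomial (Fin N × Fin N) ℂ) ^ ((e Finset.univ : ℕ) + (e ∅ : ℕ)) •
            (((1 - Matrix.of fun S T : Finset (Fin N) =>
                ∑ k : Fin N, if k ∉ S ∧ T = insert k S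
                  then ∑ c : Fin N, a S k c • (X (k, c) : MvPolynomial (Fin N × Fin N) ℂ)
                  else 0).submatrix e.symm e.symm).submatrix
              (Fin.succAbove (e Finset.univ)) (Fin.succAbove (e ∅))))
          (Grenet.repr ℂ N e) :=
  Theorems.ProjectionStabilityUniqStep.stub_gradedRigidity

/-- **S6 — variable-transpose bookkeeping.** (a) `per_N` is invariant under the transposition of its
variables (`Matrix.permanent_transpose`); (b) every matrix of polynomials is
`DetReprEquivalent (permSymmetrySubst ℂ N)` to its variable-transpose `A.map (rename Prod.swap)`: the
substitution `γ = Equiv.Perm.permMatrix ℂ (Equiv.prodComm _ _) ∈ transposeSubstSet ⊆ permSymmetrySubst`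
acts on entries as `rename Prod.swap` (`linSubst_permMatrix`). Size S/M. [folklore] -/
theorem stub_swapBookkeeping :
    (∀ N : ℕ, rename (Prod.swap : Fin N × Fin N → Fin N × Fin N) (perPoly (Fin N) ℂ) = perPoly (Fin N) ℂ) ∧
    (∀ (N m : ℕ) (A : Matrix (Fin m) (Fin m) (MvPolynomial (Fin N × Fin N) ℂ)),
      DetReprEquivalent (permSymmetrySubst ℂ N) A
        (A.map (rename (Prod.swap : Fin N × Fin N → Fin N × Fin N)))) :=
  Theorems.ProjectionStabilityUniqStep.stub_swapBookkeeping

/-- **S7 — THE BET (`SymForced`; the OptStep line's `SymStep` with the extra hypothesis `Opt (n+1)`, and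
with the structural inputs S1, S2 threaded in as `h1`, `h2`):** for `n ≥ 3`, if Grenet is optimal at level
`n`, optimal projections of `per_n` are unique modulo gauge × `permSymmetrySubst` × transpose, and Grenet is
optimal at level `n + 1`, then EVERY honest optimal projection `B` of `per_{n+1}` is symmetric for the left
monomial symmetries: `B`, or its variable-transpose `B.map (rename Prod.swap)`, is an exactly-lifted
`leftMonomialSubst ℂ (n+1)`-equivariant affine determinantal representation of `per_{n+1}`. Necessary for
`Uniq (n+1)` (Grenet is `L`-equivariant and the property is a `permSymmetrySubst`-class invariant up to the
swap), and sufficient by S3–S6 (`UniqStep_of`). Intended proof (research-level): full indecomposability and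
minimum degree ≥ 2 (S2); the `(n+1)²` Laplace restrictions `x_{n+1,j} := δ`, `x_{i,n+1} := δ` of `B` are honest
projections of `per_n` of size `2^(n+1) − 1` coming from an OPTIMAL `B`, whose live cores are optimal by a
size count and hence, by `Uniq n` + S1, gauge/symmetry images of `Grenet_n`, carrying conjugates of Grenet's
half-symmetry with scalar stabilisers; the local lifts along two variable-columns glue (Čech cocycle with
trivial coefficients) to exact lifts of generators of `leftMonomialSubst ℂ (n+1)`. Size XL. -/
theorem stub_symForced
    (h1 : ∀ n : ℕ, 1 ≤ n → IsDetProjection (perPoly (Fin n) ℂ) (2 ^ n - 1))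
    (h2 : (∀ (N m : ℕ) (c : ℂ), 3 ≤ N → c ≠ 0 →
        IsDetProjection (c • perPoly (Fin N) ℂ) m → IsDetProjection (perPoly (Fin N) ℂ) m) ∧
      (∀ N : ℕ, 3 ≤ N →
        ∀ A : Matrix (Fin (detProjectionComplexity (perPoly (Fin N) ℂ)))
            (Fin (detProjectionComplexity (perPoly (Fin N) ℂ))) (MvPolynomial (Fin N × Fin N) ℂ),
          (∀ i j, (∃ v, A i j = X v) ∨ ∃ c, A i j = C c) → A.det = perPoly (Fin N) ℂ →
          ∀ R C : Finset (Fin (detProjectionComplexity (perPoly (Fin N) ℂ))), R.Nonempty → C.Nonempty →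
            (∀ i ∈ R, ∀ j ∈ C, A i j = 0) →
            R.card + C.card < detProjectionComplexity (perPoly (Fin N) ℂ))) :
    ∀ n ≥ 3, 2 ^ n - 1 ≤ detProjectionComplexity (perPoly (Fin n) ℂ) →
      (∀ A B : Matrix (Fin (detProjectionComplexity (perPoly (Fin n) ℂ)))
          (Fin (detProjectionComplexity (perPoly (Fin n) ℂ))) (MvPolynomial (Fin n × Fin n) ℂ),
        (∀ i j, (∃ v, A i j = MvPolynomial.X v) ∨ ∃ c, A i j = MvPolynomial.C c) →
        (∀ i j, (∃ v, B i j = MvPolynomial.X v) ∨ ∃ c, B i j = MvPolynomial.C c) →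
        A.det = perPoly (Fin n) ℂ → B.det = perPoly (Fin n) ℂ →
        ∃ (P Q : GL (Fin (detProjectionComplexity (perPoly (Fin n) ℂ))) ℂ) (γ : GL (Fin n × Fin n) ℂ),
          γ ∈ permSymmetrySubst ℂ n ∧
          (B = (P : Matrix _ _ ℂ).map MvPolynomial.C * Matrix.linSubstEntries γ A * (Q : Matrix _ _ ℂ).map MvPolynomial.C ∨
            B = (P : Matrix _ _ ℂ).map MvPolynomial.C * (Matrix.linSubstEntries γ A).transpose *
              (Q : Matrix _ _ ℂ).map MvPolynomial.C)) →
      2 ^ (n + 1) - 1 ≤ detProjectionComplexity (perPoly (Fin (n + 1)) ℂ) →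
      ∀ B : Matrix (Fin (detProjectionComplexity (perPoly (Fin (n + 1)) ℂ)))
          (Fin (detProjectionComplexity (perPoly (Fin (n + 1)) ℂ))) (MvPolynomial (Fin (n + 1) × Fin (n + 1)) ℂ),
        (∀ i j, (∃ v, B i j = X v) ∨ ∃ c, B i j = C c) → B.det = perPoly (Fin (n + 1)) ℂ →
        IsEquivariantDetRepr (leftMonomialSubst ℂ (n + 1)) (perPoly (Fin (n + 1)) ℂ) B ∨
          IsEquivariantDetRepr (leftMonomialSubst ℂ (n + 1)) (perPoly (Fin (n + 1)) ℂ)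
            (B.map (rename (Prod.swap : Fin (n + 1) × Fin (n + 1) → Fin (n + 1) × Fin (n + 1)))) := by
  sorry

/-! ## Consequences and the composition -/

/-- S1 + `Opt N` (`N ≥ 1`) ⇒ the optimal size IS Grenet's: `pdc(per_N) + 1 = 2^N`. -/
theorem pdc_add_one_eq {N : ℕ} (hN : 1 ≤ N)
    (hopt : 2 ^ N - 1 ≤ detProjectionComplexity (perPoly (Fin N) ℂ)) :
    detProjectionComplexity (perPoly (Fin N) ℂ) + 1 = 2 ^ N := by
  have hle : detProjectionComplexity (perPoly (Fin N) ℂ) ≤ 2 ^ N - 1 :=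
    Nat.sInf_le (stub_grenetProjection N hN)
  have h1 : 1 ≤ 2 ^ N := Nat.one_le_two_pow
  omega

/-- Every `L`-equivariant optimal projection of `per_N` (`N ≥ 3`, `Opt N`) is in the
`permSymmetrySubst`-class of Grenet's matrix (S3 → S4 → S5). -/
theorem equiv_grenet_of_isEquivariant {N : ℕ} (hN : 3 ≤ N)
    (hopt : 2 ^ N - 1 ≤ detProjectionComplexity (perPoly (Fin N) ℂ))
    (e : Finset (Fin N) ≃ Fin (detProjectionComplexity (perPoly (Fin N) ℂ) + 1))
    {M : Matrix (Fin (detProjectionComplexity (perPoly (Fin N) ℂ)))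
      (Fin (detProjectionComplexity (perPoly (Fin N) ℂ))) (MvPolynomial (Fin N × Fin N) ℂ)}
    (hM : IsEquivariantDetRepr (leftMonomialSubst ℂ N) (perPoly (Fin N) ℂ) M) :
    DetReprEquivalent (permSymmetrySubst ℂ N) M (Grenet.repr ℂ N e) := by
  have hsz := pdc_add_one_eq (by omega : 1 ≤ N) hopt
  obtain ⟨a, hdet, hequiv⟩ := stub_lrEqualityNormalForm N _ hN hsz M hM e
  have hG := hM.of_detReprEquivalent (hequiv.mono bot_le) hdet
  obtain ⟨ρ, α, hprop⟩ := stub_orbitProportional N _ hN hsz e a hG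
  exact (hequiv.mono bot_le).trans (stub_gradedRigidity N _ hN hsz e a ρ α hprop hdet)

/-- **The line concludes the crux BY NAME**: for honest optimal `A`, `B` at level `n + 1`, S7 makes each
(or its variable-transpose, same class by S6) `L`-equivariant, and `equiv_grenet_of_isEquivariant` puts both
in the class of `Grenet.repr`; the conclusion of `UniqStep` is `DetReprEquivalent … A B` by `δ`. -/
theorem UniqStep_of :
    Summit.ValiantsHypothesis.ValiantsHypothesis.Theses.ProjectionStability.UniqStep := by
  intro n hn hopt huniq hopt' A B hA hB hdA hdB
  have hN : 3 ≤ n + 1 := by omega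
  have hsz := pdc_add_one_eq (by omega : 1 ≤ n + 1) hopt'
  have hcard : Fintype.card (Finset (Fin (n + 1))) =
      detProjectionComplexity (perPoly (Fin (n + 1)) ℂ) + 1 := by
    rw [Fintype.card_finset, Fintype.card_fin, hsz]
  let e : Finset (Fin (n + 1)) ≃ Fin (detProjectionComplexity (perPoly (Fin (n + 1)) ℂ) + 1) :=
    Fintype.equivFinOfCardEq hcard
  have key : ∀ M : Matrix (Fin (detProjectionComplexity (perPoly (Fin (n + 1)) ℂ)))
      (Fin (detProjectionComplexity (perPoly (Fin (n + 1)) ℂ))) (MvPolynomial (Fin (n + 1) × Fin (n + 1)) ℂ),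
      (∀ i j, (∃ v, M i j = X v) ∨ ∃ c, M i j = C c) → M.det = perPoly (Fin (n + 1)) ℂ →
      DetReprEquivalent (permSymmetrySubst ℂ (n + 1)) M (Grenet.repr ℂ (n + 1) e) := by
    intro M hM hdM
    rcases stub_symForced stub_grenetProjection stub_optimalStructure n hn hopt huniq hopt' M hM hdM
      with hEq | hEq
    · exact equiv_grenet_of_isEquivariant hN hopt' e hEq
    · exact (stub_swapBookkeeping.2 (n + 1) _ M).trans (equiv_grenet_of_isEquivariant hN hopt' e hEq)
  exact (key A hA hdA).trans (key B hB hdB).symm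

end

end Summit.ValiantsHypothesis.ValiantsHypothesis.Cruxes.UniqStep.Sketch
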